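import Summits.KontsevichZagierPeriods.KontsevichZagierPeriods.Theorems.RootDecompZetaThreeFrontierThreeLayerP6

/-! # `RootDecompZetaThreeFrontierThreeLayerP7` — part 7/7 of the mechanical ≤340-line split of decomp-kz lens-1 g12 `ThreeLayer_v1.lean`
(sha256 4ebbf5d0…: §18 the diagonal-straightening move Σ / un-bending τ_v and their relations, §47 the layer ⟹ words algorithm;
`…GZLadder.stub_three_layer` of «gz_ladder» v4 on stmt-KontsevichZagierPeriods-32433 is proved in part 7).  Mathematics unchanged; part 7 continues part 6. -/

set_option linter.dupNamespace false

noncomputable section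

namespace Summit.KontsevichZagierPeriods.KontsevichZagierPeriods.Cruxes.GZNormalFormWThree.GZLadder

open Set MeasureTheory Literature.NumberTheory.Transcendental
open Summit.KontsevichZagierPeriods.RootDecompZetaThreeFrontier
open Summit.KontsevichZagierPeriods.KontsevichZagierPeriods.Theorems.RootDecompZetaThreeFrontierWordMoves (ibpQ1 ibpB1 ibpT1
  dualRep3 dualRep3_integrand mem_simplex_three_duΦ)

section ThreeLayer

/-- **every monomial layer class with `α = 1`, `γ₁ = 0` is congruent into `words 3 ∪ gzLETwo`** -/
theorem wcB0 : ∀ (n : ℕ) (q : ℚ) (i j k β₀ β₁ γ₂ : ℕ), 2 * (i + j + β₀ + β₁) + k ≤ n → β₁ ≤ 1 → β₀ + β₁ ≤ 1 → γ₂ ≤ 1 →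
    WC q i j k β₀ β₁ 0 γ₂ 1 := by
  intro n
  induction n with
  | zero =>
    intro q i j k β₀ β₁ γ₂ hΦ _ _ _
    obtain rfl : i = 0 := by omega
    obtain rfl : j = 0 := by omega
    obtain rfl : k = 0 := by omega
    obtain rfl : β₀ = 0 := by omega
    obtain rfl : β₁ = 0 := by omega
    exact term_T1 q 0 0 0 0 γ₂ 1
  | succ n IH =>
    intro q i j k β₀ β₁ γ₂ hΦ hb1 h0 hg2
    by_cases hc0 : 1 ≤ i ∧ 1 ≤ β₀
    · obtain ⟨i', rfl⟩ : ∃ i', i = i' + 1 := ⟨i - 1, by omega⟩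
      obtain ⟨b', rfl⟩ : ∃ b', β₀ = b' + 1 := ⟨β₀ - 1, by omega⟩
      exact wc_of_eqOn (IH q i' j k b' β₁ γ₂ (by omega) hb1 (by omega) hg2)
        fun t ht => idCancel0 q i' j k b' β₁ 0 γ₂ 1 ht
    by_cases hc1 : 1 ≤ j ∧ 1 ≤ β₁
    · obtain ⟨j', rfl⟩ : ∃ j', j = j' + 1 := ⟨j - 1, by omega⟩
      obtain ⟨b', rfl⟩ : ∃ b', β₁ = b' + 1 := ⟨β₁ - 1, by omega⟩
      exact wc_of_eqOn (IH q i j' k β₀ b' γ₂ (by omega) (by omega) (by omega) hg2)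
        fun t ht => idCancel1 q i j' k β₀ b' 0 γ₂ 1 ht
    rcases Nat.lt_or_ge β₁ 1 with hb | hb
    · obtain rfl : β₁ = 0 := by omega
      exact term_T1 q i j k β₀ γ₂ 1
    obtain rfl : β₁ = 1 := by omega
    obtain rfl : j = 0 := by omega
    obtain rfl : β₀ = 0 := by omega
    rcases Nat.lt_or_ge γ₂ 1 with hg | hg
    · obtain rfl : γ₂ = 0 := by omega
      rcases i with _ | i'
      · exact term_E q k
      · exact wc_of_split q i' 0 k 0 1 0 0 0 q i' 0 (k + 1) 0 1 0 0 1
          (wcA _ q i' 0 k 0 1 0 0 le_rfl (by omega) (by omega) (by omega) (by omega))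
          (IH q i' 0 (k + 1) 0 1 0 (by omega) (by omega) (by omega) (by omega))
          (lint5 (by omega)) (lint5 (by omega)) fun t ht => idSplitDiagI q i' 0 k 0 1 0 0 ht
    obtain rfl : γ₂ = 1 := by omega
    rcases k with _ | k'
    swap
    · exact wc_of_split q i 0 k' 0 1 0 1 1 (-q) i 0 k' 0 1 0 0 1
        (IH q i 0 k' 0 1 1 (by omega) (by omega) (by omega) (by omega))
        (IH (-q) i 0 k' 0 1 0 (by omega) (by omega) (by omega) (by omega))
        (lint5 (by omega)) (lint5 (by omega)) fun t ht => idSplitK q i 0 k' 0 1 0 0 1 ht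
    rcases i with _ | i'
    · exact term_H q
    · exact wc_of_split q i' 0 0 0 1 0 1 0 q i' 0 1 0 1 0 1 1
        (wcA _ q i' 0 0 0 1 0 1 le_rfl (by omega) (by omega) (by omega) (by omega))
        (IH q i' 0 1 0 1 1 (by omega) (by omega) (by omega) (by omega))
        (lint5 (by omega)) (lint5 (by omega)) fun t ht => idSplitDiagI q i' 0 0 0 1 0 1 ht

/-- **every monomial layer class with `α = 1`, `γ₁ = 1` (hence `γ₂ = 0`) is congruent into `words 3 ∪ gzLETwo`** -/
theorem wcB1 : ∀ (n : ℕ) (q : ℚ) (i j k β₀ β₁ : ℕ), 2 * (i + j + β₀ + β₁) + k ≤ n → β₁ ≤ 1 → β₀ + β₁ ≤ 1 →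
    WC q i j k β₀ β₁ 1 0 1 := by
  intro n
  induction n with
  | zero =>
    intro q i j k β₀ β₁ hΦ _ _
    obtain rfl : i = 0 := by omega
    obtain rfl : j = 0 := by omega
    obtain rfl : k = 0 := by omega
    obtain rfl : β₀ = 0 := by omega
    obtain rfl : β₁ = 0 := by omega
    exact dStepG q 0 fun q' a b c => wcB0 _ q' a b c 0 1 0 le_rfl (by omega) (by omega) (by omega)
  | succ n IH =>
    intro q i j k β₀ β₁ hΦ hb1 h0
    by_cases hc0 : 1 ≤ i ∧ 1 ≤ β₀
    · obtain ⟨i', rfl⟩ : ∃ i', i = i' + 1 := ⟨i - 1, by omega⟩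
      obtain ⟨b', rfl⟩ : ∃ b', β₀ = b' + 1 := ⟨β₀ - 1, by omega⟩
      exact wc_of_eqOn (IH q i' j k b' β₁ (by omega) hb1 (by omega)) fun t ht => idCancel0 q i' j k b' β₁ 1 0 1 ht
    by_cases hc1 : 1 ≤ j ∧ 1 ≤ β₁
    · obtain ⟨j', rfl⟩ : ∃ j', j = j' + 1 := ⟨j - 1, by omega⟩
      obtain ⟨b', rfl⟩ : ∃ b', β₁ = b' + 1 := ⟨β₁ - 1, by omega⟩
      exact wc_of_eqOn (IH q i j' k β₀ b' (by omega) (by omega) (by omega)) fun t ht => idCancel1 q i j' k β₀ b' 1 0 1 ht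
    rcases j with _ | j'
    swap
    · obtain rfl : β₁ = 0 := by omega
      exact wc_of_split q i j' k β₀ 0 1 0 1 (-q) i j' k β₀ 0 0 0 1
        (IH q i j' k β₀ 0 (by omega) (by omega) (by omega)) (term_T1 (-q) i j' k β₀ 0 1)
        (lint5 (by omega)) (lint5 (by omega)) fun t ht => idSplitJ q i j' k β₀ 0 0 0 1 ht
    rcases Nat.lt_or_ge β₁ 1 with hb | hb
    swap
    · obtain rfl : β₁ = 1 := by omega
      obtain rfl : β₀ = 0 := by omega
      exact wc_of_split q i 0 k 0 1 0 0 1 q i 0 k 0 0 1 0 1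
        (wcB0 _ q i 0 k 0 1 0 le_rfl (by omega) (by omega) (by omega)) (IH q i 0 k 0 0 (by omega) (by omega) (by omega))
        (lint5 (by omega)) (lint5 (by omega)) fun t ht => idSplitB q i 0 k 0 0 0 0 1 ht
    obtain rfl : β₁ = 0 := by omega
    rcases Nat.lt_or_ge β₀ 1 with hb0 | hb0
    swap
    · obtain rfl : β₀ = 1 := by omega
      obtain rfl : i = 0 := by omega
      rcases k with _ | k'
      · exact dStepH q (wcB0 _ q 0 0 0 0 1 1 le_rfl (by omega) (by omega) (by omega))
      · exact wc_of_split q 0 0 k' 0 0 1 0 1 (-q) 0 0 k' 1 0 1 0 0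
          (IH q 0 0 k' 0 0 (by omega) (by omega) (by omega))
          (wcA _ (-q) 0 0 k' 1 0 1 0 le_rfl (by omega) (by omega) (by omega) (by omega))
          (lint5 (by omega)) (lint5 (by omega)) fun t ht => idSplitDiagK q 0 0 k' 0 0 1 0 ht
    obtain rfl : β₀ = 0 := by omega
    rcases i with _ | i'
    · exact dStepG q k fun q' a b c => wcB0 _ q' a b c 0 1 0 le_rfl (by omega) (by omega) (by omega)
    · exact wc_of_split q i' 0 k 0 0 1 0 0 q i' 0 (k + 1) 0 0 1 0 1
        (wcA _ q i' 0 k 0 0 1 0 le_rfl (by omega) (by omega) (by omega) (by omega))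
        (IH q i' 0 (k + 1) 0 0 (by omega) (by omega) (by omega))
        (lint5 (by omega)) (lint5 (by omega)) fun t ht => idSplitDiagI q i' 0 k 0 0 1 0 ht

/-- **every monomial layer class within the layer bounds is congruent into `words 3 ∪ gzLETwo`** -/
theorem wc_all (q : ℚ) (i j k : ℕ) {β₀ β₁ γ₁ γ₂ α : ℕ} (hα : α ≤ 1) (hβ : β₁ ≤ 1) (hγ : γ₁ ≤ 1)
    (h0 : β₀ + β₁ + α ≤ 2) (h1 : γ₂ + γ₁ + α ≤ 2) : WC q i j k β₀ β₁ γ₁ γ₂ α := by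
  rcases Nat.lt_or_ge α 1 with ha | ha
  · obtain rfl : α = 0 := by omega
    exact wcA _ q i j k β₀ β₁ γ₁ γ₂ le_rfl hβ hγ (by omega) (by omega)
  obtain rfl : α = 1 := by omega
  rcases Nat.lt_or_ge γ₁ 1 with hg | hg
  · obtain rfl : γ₁ = 0 := by omega
    exact wcB0 _ q i j k β₀ β₁ γ₂ le_rfl hβ (by omega) (by omega)
  obtain rfl : γ₁ = 1 := by omega
  obtain rfl : γ₂ = 0 := by omega
  exact wcB1 _ q i j k β₀ β₁ le_rfl hβ (by omega)

/-- **`gz_ladder.stub_three_layer`, PROVED** — by name and signature of the registered skeleton (`gz_ladder` v4 on item 32433):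
every LAYER datum of dimension 3 is congruent, modulo KZ moves, into the span of the words of weight `≤ 3` and the genus-zero
data of dimension `≤ 2`. -/
theorem stub_three_layer : ∀ s : KZ.IntegralRep 3, IsLayerThree s → CongInto (words 3 ∪ gzLETwo) (KZ.of s) := by
  intro s hs
  obtain ⟨hd, p, β₀, β₁, γ₁, γ₂, α, hα, hβ, hγ, h0, h1, hi⟩ := hs
  exact congT_of_poly p β₀ β₁ γ₁ γ₂ α hα hβ hγ h0 h1 (fun m _ => wc_all _ _ _ _ hα hβ hγ h0 h1) s hd
    fun t ht => by rw [hi ht]; rfl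

end ThreeLayer

end Summit.KontsevichZagierPeriods.KontsevichZagierPeriods.Cruxes.GZNormalFormWThree.GZLadder
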